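import Summits.BirchSwinnertonDyer.BirchSwinnertonDyer.Theorems.ResidualThetaTransportAtTwoResidualSignedLambdaLowerCMAtTwoRhoLayerPairingCompat
import Summits.BirchSwinnertonDyer.BirchSwinnertonDyer.Theorems.ThetaPartnerAtTwoSignedMainConjectureCMTwoRankZeroPTDeepTransferTools
import Summits.BirchSwinnertonDyer.BirchSwinnertonDyer.Theorems.ResidualThetaTransportAtTwoUnramifiedRestriction
import Summits.BirchSwinnertonDyer.BirchSwinnertonDyer.Theorems.ResidualThetaTransportAtTwoThetaTransportResidualUnramified
import Literature.NumberTheory.EllipticCurves.CyclotomicLayerThetaKummer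
import Literature.NumberTheory.EllipticCurves.IwasawaSelmerProofs
import Literature.NumberTheory.EllipticCurves.PeriodIndexCorestrictionLocal
import HarnessLib

/-!
# T3♮ — the Kummer-witness TRANSPORT at `v ∣ p` for the `ρ`-coefficient transfer: a level class whose localisation IS a Θ-transported
# layer Kummer class of SIGNED points transfers into clause (3) (the PLUS/signed Kummer clause) of RSL_g's counted set

Route `ResidualThetaTransportAtTwo` (RTT), crux RSL_g `ResidualSignedLambdaLowerCMAtTwo` (stmt-BirchSwinnertonDyer-22608), line «onepair», S57 split
item 6 (S4₂ `stub_deepHalfAtTwoStrict`); seat `prover-bsd-wall-tp2-p2x-w2` g19 (`--supports`, closes nothing). THEOREMS ONLY (no definition, no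
named fact, no instance, no `sorry`). STUB-PLAN rev 19 Q79 / S78 «item 6 residue = T3♮» (credit: stub-ideation card k3-g13 for the transfer; this
file is the `ρ`-twin of TP2's `SignedLowerOffTwo.PTDeep.exists_kummerWitness_push_of_layerLoc_eq_layerKummer` /
`conjH1_mem_localKummerOverOfEmb_signed`, `…PTDeepTransferTools.lean` §4). BSD is not proved by any of this; RSL_g (22608) stays OPEN.

SETTING. `ρ : Γ_ℚ → GL_d(𝒪)` framed, `A_ρ = Cofree ρ F`, `A_ρ[p^k] = torsionBy A_ρ (p^k)` (`cofreeTorsionGaloisModule S ρ (p^k)`), `W/ℚ` a Weierstrass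
curve, a transport `Θ : A_ρ ≃+ E[p^∞]^r` equivariant at `v` (`hΘ`, the crux binder verbatim), `κ` the cyclotomic `ℤ_p`-extension, `U_n = layerGroup κ v n`.
The `ρ`-side layer localisation is `CyclotomicLayer.layerLocOf (cofreeTorsionGaloisModule S ρ (p^k)) κ v n : H¹(Γ_n, A_ρ[p^k]) → H¹(U_n, A_ρ[p^k]|)`
and the Θ-transported layer Kummer map is `CyclotomicLayer.thetaLayerKummer … : E(ℚ_{n,v})^r →+ H¹(U_n, A_ρ[p^k]|)` (K-c, `CyclotomicLayerThetaKummer`).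
The transfer is `τ_{n} = res_{Γ_∞ ≤ Γ_n} ∘ (A_ρ[p^k] ↪ A_ρ)_*` (spelled `resOfLe (Cofree ρ F) (κ.kerSubgroup_le_layerSubgroup n) (pushH1 (κ.layerSubgroup n)
(A_ρ[p^k]).subtype _ c)`, as in `…CofreeSelmerTransfer.lean`).

WHAT.
* §1 **`exists_thetaKummerWitness_of_layerLocOf_eq_thetaLayerKummer`** ([kum] ⟹ a Θ-Kummer WITNESS): if `loc_n c = thetaLayerKummer Q₀` then `c`
  has a cocycle `β` and roots `R` (`p^k • R i = Q₀ i`) with `(closureEmb (K := ℚ) (v.adicCompletion ℚ))(Θ(β(res τ))_i) = τ R_i − R_i` on `U_n` (the two cocycles differ on `U_n` by a coboundary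
  `τ t − t`, `t ∈ A_ρ[p^k]`; `R_i = Q'_i + (closureEmb (K := ℚ) (v.adicCompletion ℚ))((Θ t)_i)` for roots `Q'_i` of `Q₀ i`; `sum_thetaSingle` reads `Θ` off the Kummer side).
* §2 **`thetaKummerWitness_conj`**: the conjugate cocycle `conj_{θ(d)} β`, `d ∈ Γ_{ℚ_v}`, has the witness `d • R` (through `hΘ` and `pointsMapOfEmb_smul`).
* §3 **`exists_signed_thetaKummerWitness_conjH1_transfer`** (T3♮): at `v ∣ p`, `κ` cyclotomic, if `Q₀ i ∈ E^ε(ℚ_{n,v})` for all `i` then for EVERY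
  `σ ∈ Γ_ℚ` the class `conj_σ (τ_n c) ∈ H¹(Γ_∞, A_ρ)` has a triple `(φ, Q, k)` — a representative cocycle, points `Q = d • R` with
  `p^k • Q i ∈ ⨆_m E^ε(ℚ_{m,v})` (`E^ε_n` is `Γ_v`-stable, `smul_mem_signedLocalPointsOfEmb`), and the Kummer identity
  `(closureEmb (K := ℚ) (v.adicCompletion ℚ))(Θ(φ(res τ))_i) = τ Q_i − Q_i` on `Gal(ℚ̄_v/ℚ_{∞,v})` — i.e. EXACTLY clause (3) of RSL_g's counted set (one orbit `Γ_ℚ = θ(Γ_v)·Γ_n`,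
  `forall_exists_inv_mul_mem_layerSubgroup`; `conj_u = id` on `H¹(Γ_n, ·)` for `u ∈ Γ_n`).

References: [Kobayashi2003] Def. 1.1, §2 (p. 4), (8.23) (p. 18); [SilvermanAEC2009] VIII §2; [SerreGaloisCohomology1997] I §2.2–2.5, §5.1;
[SerreLocalFields1979] VII §5 Prop. 3; [NeukirchSchmidtWingberg2008] I §5; [Greenberg1989] §1 p. 98; [Washington1997] §13.1.
-/

set_option autoImplicit false
-- the Theorems namespace of this sub repeats the summit name by design (D-0017 nested layout)
set_option linter.dupNamespace false

noncomputable section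

open scoped Classical NumberField

namespace Summit.BirchSwinnertonDyer.BirchSwinnertonDyer.Theorems.ThetaTransport.CofreeSelmerTransfer

open CategoryTheory Field NumberField IsDedekindDomain
  Literature.NumberTheory.EllipticCurves Literature.NumberTheory.GaloisRepresentations
  Literature.NumberTheory.EllipticCurves.Kobayashi2003 Literature.NumberTheory.EllipticCurves.GreenbergVatsal2000
  Literature.NumberTheory.EllipticCurves.GreenbergSelmer Literature.NumberTheory.EllipticCurves.CyclotomicLayer
  Literature.NumberTheory.GaloisCohomology ZpExtension
  Summit.BirchSwinnertonDyer.BirchSwinnertonDyer.Theorems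

variable {p : ℕ} [Fact p.Prime] (S : Set (PadicAlgCl p)) {d : ℕ} (ρ : FramedGaloisRep ℚ ↥(padicCoeffIntegers S) d)
  (k : ℕ) (W : WeierstrassCurve ℚ) [W.IsElliptic] {r : ℕ}
  (Θ : Cofree ρ ↥(padicCoeffField S) ≃+ (Fin r → ↥(W.geomPrimaryTorsion p))) (κ : ZpExtension ℚ p)
  (v : HeightOneSpectrum (𝓞 ℚ))
  (hΘ : ∀ (δ : absoluteGaloisGroup (v.adicCompletion ℚ)) (m : Cofree ρ ↥(padicCoeffField S)) (i : Fin r),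
    Θ (resGalOfEmb (closureEmb (K := ℚ) (v.adicCompletion ℚ)) δ • m) i =
      resGalOfEmb (closureEmb (K := ℚ) (v.adicCompletion ℚ)) δ • Θ m i)

/-! ## §1 [kum] ⟹ a Θ-Kummer witness for the level class -/

-- the coercion towers `A_ρ[p^k] ↪ A_ρ →Θ E[p^∞]^r ↪ E(ℚ̄)^r → E(ℚ̄_v)^r` and the two cohomology dialects (`discreteTopRep` /
-- `subgroupRep … .toTopRep`, definitionally equal) make the defeq checks of this proof exceed the default budget (as in `…RhoLayerPairingCompat`)
set_option maxHeartbeats 1600000 in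
include hΘ in
/-- **[kum] ⟹ Θ-Kummer witness.** If the localisation at the layer of `c ∈ H¹(Γ_n, A_ρ[p^k])` is the Θ-transported layer Kummer class of
`Q₀ ∈ E(ℚ_{n,v})^r` (`layerLocOf … c = thetaLayerKummer … Q₀`), then `c` has a representative `β` and roots `R` (`p^k • R i = Q₀ i`) with
`(closureEmb (K := ℚ) (v.adicCompletion ℚ))(Θ(β(res τ))_i) = τ R_i − R_i` for all `τ ∈ U_n`: the two cocycles differ on `U_n` by a coboundary `τ t − t` (`t ∈ A_ρ[p^k]`); put
`R_i := Q'_i + (closureEmb (K := ℚ) (v.adicCompletion ℚ))((Θ t)_i)` with `p^k Q'_i = Q₀ i`. (`ρ`-twin of TP2 `exists_kummerWitness_push_of_layerLoc_eq_layerKummer`.)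
[cite: Kobayashi2003, §2 (p. 4), (8.23) (p. 18)] [cite: SilvermanAEC2009, VIII §2] [cite: SerreGaloisCohomology1997, I §2.2] -/
theorem exists_thetaKummerWitness_of_layerLocOf_eq_thetaLayerKummer (n : ℕ)
    (c : H1 (cofreeTorsionGaloisModule S ρ ((p ^ k : ℕ) : ℤ)) (κ.layerSubgroup n))
    (Q₀ : Fin r → ↥(localLayerPointsOfEmb κ (closureEmb (K := ℚ) (v.adicCompletion ℚ)) W n))
    (hkum : layerLocOf (cofreeTorsionGaloisModule S ρ ((p ^ k : ℕ) : ℤ)) κ v n c =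
      thetaLayerKummer S ρ k W Θ κ v hΘ n Q₀) :
    ∃ (β : contOneCocycles (discreteTopRep (κ.layerSubgroup n)
        ↥(AddSubgroup.torsionBy (Cofree ρ ↥(padicCoeffField S)) ((p ^ k : ℕ) : ℤ))))
      (R : Fin r → localPoints W (v.adicCompletion ℚ)),
      oneCocycleClass _ β = c ∧ (∀ i, (p ^ k) • R i = (Q₀ i : localPoints W (v.adicCompletion ℚ))) ∧
      ∀ (τ : layerGroup κ v n) (i : Fin r),
        pointsMapOfEmb W (closureEmb (K := ℚ) (v.adicCompletion ℚ))
            ((Θ ((β.1 (resGalSubgroupOfEmb (κ.layerSubgroup n) (closureEmb (K := ℚ) (v.adicCompletion ℚ)) τ) :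
              ↥(AddSubgroup.torsionBy (Cofree ρ ↥(padicCoeffField S)) ((p ^ k : ℕ) : ℤ))) : Cofree ρ ↥(padicCoeffField S)) i :
              ↥(W.geomPrimaryTorsion p)) : W.geomPoints) =
          (τ : absoluteGaloisGroup (v.adicCompletion ℚ)) • R i - R i := by
  have hN : ((p ^ k : ℕ) : ℤ) ≠ 0 := by exact_mod_cast pow_ne_zero k (Fact.out : p.Prime).ne_zero
  -- a cocycle of `c`
  obtain ⟨β, rfl⟩ := oneCocycleClass_surjective _ c
  -- roots of the points (no `set`: opaque roots suffice) and their Kummer cocycles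
  obtain ⟨Q', hR⟩ : ∃ Q' : Fin r → localPoints W (v.adicCompletion ℚ),
      ∀ i, ((p ^ k : ℕ) : ℤ) • Q' i = (Q₀ i : localPoints W (v.adicCompletion ℚ)) :=
    ⟨fun i ↦ W.subgroupZSMulRoot ((p ^ k : ℕ) : ℤ) hN (Q₀ i : localPoints W (v.adicCompletion ℚ)),
      fun i ↦ W.zsmul_subgroupZSMulRoot _ hN _⟩
  have hfix : ∀ i, ((p ^ k : ℕ) : ℤ) • Q' i ∈
      FixedPoints.addSubgroup (layerGroup κ v n) (localPoints W (v.adicCompletion ℚ)) := fun i ↦ by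
    rw [hR]; exact (Q₀ i).2
  have hK : ∀ i, layerKummer W (p ^ k) κ v n (Q₀ i) =
      oneCocycleClass _ (W.subgroupKummerCocycle ((p ^ k : ℕ) : ℤ) (layerGroup κ v n) hN (Q' i) (hfix i)) := fun i ↦ by
    change W.subgroupKummerMap ((p ^ k : ℕ) : ℤ) (layerGroup κ v n) hN (Q₀ i) = _
    rw [W.subgroupKummerMap_apply_eq _ _ hN (Q₀ i) (Q' i) (hfix i) (hR i)]
    rfl
  -- the Θ-Kummer class as ONE explicit cocycle
  have hT : thetaLayerKummer S ρ k W Θ κ v hΘ n Q₀ =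
      oneCocycleClass (subgroupRep (cofreeTorsionLocalRep S ρ ((p ^ k : ℕ) : ℤ) v) (layerGroup κ v n))
        (∑ i, contOneCocycles.pushAddHom (thetaSingle ρ p k W Θ i) continuous_of_discreteTopology
          (thetaSingle_subgroupRep S ρ k W Θ κ v hΘ i n)
          (W.subgroupKummerCocycle ((p ^ k : ℕ) : ℤ) (layerGroup κ v n) hN (Q' i) (hfix i))) := by
    rw [thetaLayerKummer_apply, ← oneCocycleClassₗ_apply, map_sum]
    refine Finset.sum_congr rfl fun i _ ↦ ?_
    rw [oneCocycleClassₗ_apply, hK i, thetaSingleH1_oneCocycleClass]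
  -- [kum] on cocycles: `β ∘ res` and the sum differ by a coboundary
  have hL := layerLocOf_oneCocycleClass (v := v) (cofreeTorsionGaloisModule S ρ ((p ^ k : ℕ) : ℤ)) κ n β
  rw [hL, hT, ← sub_eq_zero, ← oneCocycleClass_sub, oneCocycleClass_eq_zero_iff] at hkum
  obtain ⟨t, ht⟩ := hkum
  have hR' : ∀ i, (p ^ k) • Q' i = (Q₀ i : localPoints W (v.adicCompletion ℚ)) := fun i ↦ by
    rw [← natCast_zsmul]; exact_mod_cast hR i
  refine ⟨β, fun i ↦ pointsMapOfEmb W (closureEmb (K := ℚ) (v.adicCompletion ℚ)) (((Θ ((t :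
      ↥(AddSubgroup.torsionBy (Cofree ρ ↥(padicCoeffField S)) ((p ^ k : ℕ) : ℤ))) : Cofree ρ ↥(padicCoeffField S)) i :
      ↥(W.geomPrimaryTorsion p)) : W.geomPoints)) + Q' i, rfl, fun i ↦ ?_, fun τ i ↦ ?_⟩
  · -- `p^k • (ι (Θ t)_i + Q'_i) = Q₀ i`
    have ht0 : (p ^ k) • (((Θ ((t : ↥(AddSubgroup.torsionBy (Cofree ρ ↥(padicCoeffField S)) ((p ^ k : ℕ) : ℤ))) :
        Cofree ρ ↥(padicCoeffField S)) i : ↥(W.geomPrimaryTorsion p)) : W.geomPoints)) = 0 := by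
      have h := (WeierstrassCurve.mem_geomTorsion_iff W _ _).1 (coe_theta_apply_mem_geomTorsion ρ p k W Θ t i)
      rwa [natCast_zsmul] at h
    rw [smul_add, hR', ← map_nsmul, ht0, map_zero, zero_add]
  · -- the values at `τ ∈ U_n`, read through `Θ`, coordinate `i`, `(closureEmb (K := ℚ) (v.adicCompletion ℚ))`
    have h := ht τ
    -- unfold the difference cocycle at `τ`
    have e1 : (contOneCocycles.pullback (resGalSubgroupOfEmb (κ.layerSubgroup n) (closureEmb (K := ℚ) (v.adicCompletion ℚ)))
          (X := subgroupRep (cofreeTorsionGaloisModule S ρ ((p ^ k : ℕ) : ℤ)).toTopRep (κ.layerSubgroup n))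
          (Y := subgroupRep (localRepOf (cofreeTorsionGaloisModule S ρ ((p ^ k : ℕ) : ℤ)) v) (layerGroup κ v n))
          (TopRep.ofHom ⟨ContinuousLinearMap.id ℤ _, fun _ ↦ rfl⟩) β -
          ∑ i, contOneCocycles.pushAddHom (thetaSingle ρ p k W Θ i) continuous_of_discreteTopology
            (thetaSingle_subgroupRep S ρ k W Θ κ v hΘ i n)
            (W.subgroupKummerCocycle ((p ^ k : ℕ) : ℤ) (layerGroup κ v n) hN (Q' i) (hfix i))).1 τ =
        β.1 (resGalSubgroupOfEmb (κ.layerSubgroup n) (closureEmb (K := ℚ) (v.adicCompletion ℚ)) τ) -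
          ∑ i, thetaSingle ρ p k W Θ i ((W.subgroupKummerCocycle ((p ^ k : ℕ) : ℤ) (layerGroup κ v n) hN (Q' i) (hfix i)).1 τ) := by
      rw [Submodule.coe_sub, ContinuousMap.sub_apply, Submodule.coe_sum, ContinuousMap.sum_apply]
      rfl
    rw [e1, sub_eq_iff_eq_add] at h
    -- apply `Θ`, coordinate `i`, to `E(ℚ̄)` and then `(closureEmb (K := ℚ) (v.adicCompletion ℚ))`
    have h2 := congrArg (fun x : ↥(AddSubgroup.torsionBy (Cofree ρ ↥(padicCoeffField S)) ((p ^ k : ℕ) : ℤ)) ↦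
      pointsMapOfEmb W (closureEmb (K := ℚ) (v.adicCompletion ℚ)) (((Θ (x : Cofree ρ ↥(padicCoeffField S)) i : ↥(W.geomPrimaryTorsion p)) : W.geomPoints))) h
    simp only at h2
    rw [h2, AddSubgroup.coe_add, AddSubgroup.coe_sub, AddSubmonoidClass.coe_finsetSum, sum_thetaSingle,
      map_add, map_sub, AddEquiv.apply_symm_apply, Pi.add_apply, Pi.sub_apply]
    -- the action on `t`: `Θ (τ • t) i = τ • Θ t i`
    have hρ : ((((subgroupRep (cofreeTorsionLocalRep S ρ ((p ^ k : ℕ) : ℤ) v) (layerGroup κ v n)).ρ τ t :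
        ↥(AddSubgroup.torsionBy (Cofree ρ ↥(padicCoeffField S)) ((p ^ k : ℕ) : ℤ))) : Cofree ρ ↥(padicCoeffField S))) =
          resGalOfEmb (closureEmb (K := ℚ) (v.adicCompletion ℚ)) (τ : absoluteGaloisGroup (v.adicCompletion ℚ)) • (t : Cofree ρ ↥(padicCoeffField S)) := rfl
    rw [hρ, hΘ, AddSubgroup.coe_add, AddSubgroup.coe_sub, map_add, map_sub, primaryComponent.coe_smul, pointsMapOfEmb_smul,
      AddSubgroup.coe_inclusion]
    -- the Kummer cocycle read on points
    have hkum' : pointsMapOfEmb W (closureEmb (K := ℚ) (v.adicCompletion ℚ)) (((W.subgroupKummerCocycle ((p ^ k : ℕ) : ℤ) (layerGroup κ v n) hN (Q' i) (hfix i)).1 τ :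
        W.geomTorsion ((p ^ k : ℕ) : ℤ)) : W.geomPoints) = (τ : absoluteGaloisGroup (v.adicCompletion ℚ)) • Q' i - Q' i :=
      W.pointsMap_subgroupKummerCocycle_apply _ _ hN (Q' i) (hfix i) τ
    rw [hkum', smul_add, add_sub_add_comm]

/-! ## §2 Conjugating a Θ-Kummer witness by `d ∈ Γ_{ℚ_v}` -/

omit [W.IsElliptic] in
include hΘ in
/-- **The conjugate of a Θ-Kummer witness** (`ρ`-twin of TP2 `kummerWitness_conj_layer`): if `(closureEmb (K := ℚ) (v.adicCompletion ℚ))(Θ(β(res τ))_i) = τ R_i − R_i` on `U_n` then the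
conjugate cocycle `conj_{θ(d)} β` (`θ = resGalOfEmb (closureEmb ℚ_v)`, `d ∈ Γ_{ℚ_v}`) satisfies `(closureEmb (K := ℚ) (v.adicCompletion ℚ))(Θ((conj_{θ(d)} β)(res τ))_i) = τ (d R_i) − d R_i`
(`(conj β)(h) = θ(d) • β(θ(d)⁻¹ h θ(d))`, `hΘ`, `pointsMapOfEmb_smul`). [cite: SerreGaloisCohomology1997, I §2.5] [cite: Kobayashi2003, §2 (p. 4)] -/
theorem thetaKummerWitness_conj (n : ℕ) {N : ℤ} (dd : absoluteGaloisGroup (v.adicCompletion ℚ))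
    {β : contOneCocycles (discreteTopRep (κ.layerSubgroup n) ↥(AddSubgroup.torsionBy (Cofree ρ ↥(padicCoeffField S)) N))}
    {R : Fin r → localPoints W (v.adicCompletion ℚ)}
    (hβ : ∀ (τ : layerGroup κ v n) (i : Fin r),
      pointsMapOfEmb W (closureEmb (K := ℚ) (v.adicCompletion ℚ))
          ((Θ ((β.1 (resGalSubgroupOfEmb (κ.layerSubgroup n) (closureEmb (K := ℚ) (v.adicCompletion ℚ)) τ) :
            ↥(AddSubgroup.torsionBy (Cofree ρ ↥(padicCoeffField S)) N)) : Cofree ρ ↥(padicCoeffField S)) i :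
            ↥(W.geomPrimaryTorsion p)) : W.geomPoints) =
        (τ : absoluteGaloisGroup (v.adicCompletion ℚ)) • R i - R i)
    (τ : layerGroup κ v n) (i : Fin r) :
    pointsMapOfEmb W (closureEmb (K := ℚ) (v.adicCompletion ℚ))
        ((Θ (((conjCocycle (κ.layerSubgroup n) (resGalOfEmb (closureEmb (K := ℚ) (v.adicCompletion ℚ)) dd) β).1
          (resGalSubgroupOfEmb (κ.layerSubgroup n) (closureEmb (K := ℚ) (v.adicCompletion ℚ)) τ) :
          ↥(AddSubgroup.torsionBy (Cofree ρ ↥(padicCoeffField S)) N)) : Cofree ρ ↥(padicCoeffField S)) i :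
          ↥(W.geomPrimaryTorsion p)) : W.geomPoints) =
      (τ : absoluteGaloisGroup (v.adicCompletion ℚ)) • (dd • R i) - dd • R i := by
  have hτ' : dd⁻¹ * (τ : absoluteGaloisGroup (v.adicCompletion ℚ)) * dd ∈ layerGroup κ v n := by
    rw [mem_localSubgroupOfEmb_iff, map_mul, map_mul, map_inv]
    exact (κ.layerSubgroup_normal n).conj_mem' _ ((mem_localSubgroupOfEmb_iff (κ.layerSubgroup n) (closureEmb (K := ℚ) (v.adicCompletion ℚ)) _).1 τ.2) _
  have hconj : subgroupConj (κ.layerSubgroup n) (resGalOfEmb (closureEmb (K := ℚ) (v.adicCompletion ℚ)) dd) (resGalSubgroupOfEmb (κ.layerSubgroup n) (closureEmb (K := ℚ) (v.adicCompletion ℚ)) τ) =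
      resGalSubgroupOfEmb (κ.layerSubgroup n) (closureEmb (K := ℚ) (v.adicCompletion ℚ)) ⟨dd⁻¹ * (τ : absoluteGaloisGroup (v.adicCompletion ℚ)) * dd, hτ'⟩ := by
    apply Subtype.ext
    rw [subgroupConj_apply_coe, resGalSubgroupOfEmb_apply_coe, resGalSubgroupOfEmb_apply_coe, map_mul, map_mul, map_inv]
  rw [conjCocycle_apply, hconj, AddSubgroup.torsionBy.coe_smul, hΘ, primaryComponent.coe_smul, pointsMapOfEmb_smul, hβ ⟨_, hτ'⟩,
    smul_sub, smul_smul, smul_smul]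
  congr 1
  rw [show dd * (dd⁻¹ * (τ : absoluteGaloisGroup (v.adicCompletion ℚ)) * dd) =
    (τ : absoluteGaloisGroup (v.adicCompletion ℚ)) * dd by group, mul_smul]

/-! ## §3 T3♮: the signed Kummer clause (3) of RSL_g's counted set for every conjugate of the transferred class -/

-- same coercion towers as §1 (the witness is transported through `conj`, `push`, `res`)
set_option maxHeartbeats 1600000 in
include hΘ in
/-- **T3♮ (Kummer-witness TRANSPORT at `v ∣ p`, all conjugates).** `κ` cyclotomic, `v ∣ p`, `c ∈ H¹(Γ_n, A_ρ[p^k])` with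
`layerLocOf … c = thetaLayerKummer … Q₀` for SIGNED layer points `Q₀ i ∈ E^ε(ℚ_{n,v})`. Then for EVERY `σ ∈ Γ_ℚ` the conjugate
`conj_σ (τ_n c)` of the transferred class `τ_n c = res_{Γ_∞ ≤ Γ_n}((A_ρ[p^k] ↪ A_ρ)_* c) ∈ H¹(Γ_∞, A_ρ)` admits a triple `(φ, Q, k)`:
`[φ] = conj_σ (τ_n c)`, `p^k • Q i ∈ ⨆_m E^ε(ℚ_{m,v})`, and `(closureEmb (K := ℚ) (v.adicCompletion ℚ))(Θ(φ(res τ))_i) = τ Q_i − Q_i` for all `τ ∈ Gal(ℚ̄_v/ℚ_{∞,v})` — VERBATIM the shape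
of clause (3) of RSL_g's counted set (there `p = 2`, `ε = 1`, `Θ = Θ v hv`). Proof: `σ = θ(d)·u` with `u ∈ Γ_n` (one orbit,
`forall_exists_inv_mul_mem_layerSubgroup`), `conj_u = id` on `H¹(Γ_n, ·)`, `conj`/push/res commute, §1 and §2 with `Q = d • R`, and
`E^ε(ℚ_{n,v})` is `Γ_v`-stable (`smul_mem_signedLocalPointsOfEmb`). [cite: Kobayashi2003, Def. 1.1, §2 (p. 4), (8.23) (p. 18)]
[cite: SerreLocalFields1979, VII §5 Prop. 3] [cite: Washington1997, §13.1] -/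
theorem exists_signed_thetaKummerWitness_conjH1_transfer (hκ : κ.IsCyclotomic) (hv : (p : 𝓞 ℚ) ∈ v.asIdeal) (ε : ℤˣ) (n : ℕ)
    (c : H1 (cofreeTorsionGaloisModule S ρ ((p ^ k : ℕ) : ℤ)) (κ.layerSubgroup n))
    (Q₀ : Fin r → ↥(localLayerPointsOfEmb κ (closureEmb (K := ℚ) (v.adicCompletion ℚ)) W n))
    (hQ₀ : ∀ i, (Q₀ i : localPoints W (v.adicCompletion ℚ)) ∈ signedLocalPoints κ (v.adicCompletion ℚ) W ε n)
    (hkum : layerLocOf (cofreeTorsionGaloisModule S ρ ((p ^ k : ℕ) : ℤ)) κ v n c =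
      thetaLayerKummer S ρ k W Θ κ v hΘ n Q₀)
    (σ : absoluteGaloisGroup ℚ) :
    ∃ (φ : contOneCocycles (discreteTopRep κ.kerSubgroup (Cofree ρ ↥(padicCoeffField S))))
      (Q : Fin r → localPoints W (v.adicCompletion ℚ)) (k' : ℕ),
      oneCocycleClass (discreteTopRep κ.kerSubgroup (Cofree ρ ↥(padicCoeffField S))) φ =
        conjH1 κ.kerSubgroup (Cofree ρ ↥(padicCoeffField S)) σ
          (resOfLe (Cofree ρ ↥(padicCoeffField S)) (κ.kerSubgroup_le_layerSubgroup n)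
            (pushH1 (κ.layerSubgroup n) (AddSubgroup.torsionBy (Cofree ρ ↥(padicCoeffField S)) ((p ^ k : ℕ) : ℤ)).subtype
              (fun _ _ ↦ rfl) c)) ∧
      (∀ i, (p ^ k') • Q i ∈ ⨆ m : ℕ, signedLocalPoints κ (v.adicCompletion ℚ) W ε m) ∧
      ∀ (τ : localSubgroupOfEmb κ.kerSubgroup (closureEmb (K := ℚ) (v.adicCompletion ℚ))) (i : Fin r),
        pointsMapOfEmb W (closureEmb (K := ℚ) (v.adicCompletion ℚ))
            ((Θ (φ.1 (resGalSubgroupOfEmb κ.kerSubgroup (closureEmb (K := ℚ) (v.adicCompletion ℚ)) τ)) i :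
              ↥(W.geomPrimaryTorsion p)) : W.geomPoints) =
          (τ : absoluteGaloisGroup (v.adicCompletion ℚ)) • Q i - Q i := by
  -- one orbit: `σ = θ(d) · u`, `u ∈ Γ_n`
  obtain ⟨dd, hd⟩ := SignedKatoOffTwo.LayerPairing.forall_exists_inv_mul_mem_layerSubgroup κ v hκ hv n σ
  have hσ : σ = resGalOfEmb (closureEmb (K := ℚ) (v.adicCompletion ℚ)) dd * ((resGalOfEmb (closureEmb (K := ℚ) (v.adicCompletion ℚ)) dd)⁻¹ * σ) := by rw [mul_inv_cancel_left]
  -- the witness at level `n`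
  obtain ⟨β, R, hβc, hR, hβ⟩ := exists_thetaKummerWitness_of_layerLocOf_eq_thetaLayerKummer S ρ k W Θ κ v hΘ n c Q₀ hkum
  -- the cocycle of `conj_σ (τ_n c)`: restrict-to-`Γ_∞` ∘ push ∘ conj_{θ(d)} of `β`
  refine ⟨contOneCocycles.pullback (subgroupInclusion (κ.kerSubgroup_le_layerSubgroup n))
      (resHomOfEquivariant (subgroupInclusion (κ.kerSubgroup_le_layerSubgroup n)) (AddMonoidHom.id (Cofree ρ ↥(padicCoeffField S)))
        (fun _ _ ↦ rfl))
      (contOneCocycles.pullback (ContinuousMonoidHom.id (κ.layerSubgroup n))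
        (resHomOfEquivariant (ContinuousMonoidHom.id (κ.layerSubgroup n))
          (AddSubgroup.torsionBy (Cofree ρ ↥(padicCoeffField S)) ((p ^ k : ℕ) : ℤ)).subtype (fun _ _ ↦ rfl))
        (conjCocycle (κ.layerSubgroup n) (resGalOfEmb (closureEmb (K := ℚ) (v.adicCompletion ℚ)) dd) β)),
    fun i ↦ dd • R i, k, ?_, fun i ↦ ?_, fun τ i ↦ ?_⟩
  · -- the class
    have e1 : conjH1 κ.kerSubgroup (Cofree ρ ↥(padicCoeffField S)) σ
        (resOfLe (Cofree ρ ↥(padicCoeffField S)) (κ.kerSubgroup_le_layerSubgroup n)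
          (pushH1 (κ.layerSubgroup n) (AddSubgroup.torsionBy (Cofree ρ ↥(padicCoeffField S)) ((p ^ k : ℕ) : ℤ)).subtype
            (fun _ _ ↦ rfl) c)) =
        resOfLe (Cofree ρ ↥(padicCoeffField S)) (κ.kerSubgroup_le_layerSubgroup n)
          (pushH1 (κ.layerSubgroup n) (AddSubgroup.torsionBy (Cofree ρ ↥(padicCoeffField S)) ((p ^ k : ℕ) : ℤ)).subtype
            (fun _ _ ↦ rfl) (conjH1 (κ.layerSubgroup n) ↥(AddSubgroup.torsionBy (Cofree ρ ↥(padicCoeffField S)) ((p ^ k : ℕ) : ℤ)) (resGalOfEmb (closureEmb (K := ℚ) (v.adicCompletion ℚ)) dd) c)) := by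
      have e := congrArg (fun f ↦ f (pushH1 (κ.layerSubgroup n)
        (AddSubgroup.torsionBy (Cofree ρ ↥(padicCoeffField S)) ((p ^ k : ℕ) : ℤ)).subtype (fun _ _ ↦ rfl) c))
        (resOfLe_comp_conjH1_holds (M := Cofree ρ ↥(padicCoeffField S)) (κ.kerSubgroup_le_layerSubgroup n) σ)
      simp only [AddMonoidHom.coe_comp, Function.comp_apply] at e
      rw [← e, ThetaTransport.conjH1_pushH1, hσ, conjH1_mul_holds, AddMonoidHom.comp_apply,
        conjH1_of_mem_holds (κ.layerSubgroup n) ↥(AddSubgroup.torsionBy (Cofree ρ ↥(padicCoeffField S)) ((p ^ k : ℕ) : ℤ)) hd, AddMonoidHom.id_apply]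
    rw [e1, ← hβc, conjH1_oneCocycleClass, resH1Hom_oneCocycleClass, ResidualLayer.resOfLe_oneCocycleClass]
  · -- `p^k • (d • R i) = d • Q₀ i ∈ E^ε_n ≤ ⨆_m E^ε_m`
    rw [smul_comm, hR i]
    exact AddSubgroup.mem_iSup_of_mem n (SignedLowerOffTwo.PTDeep.smul_mem_signedLocalPointsOfEmb κ (closureEmb (K := ℚ) (v.adicCompletion ℚ)) W ε n dd (hQ₀ i))
  · -- the values on `Gal(ℚ̄_v/ℚ_{∞,v}) ≤ U_n`
    have hτn : (τ : absoluteGaloisGroup (v.adicCompletion ℚ)) ∈ layerGroup κ v n :=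
      κ.kerSubgroup_le_layerSubgroup n ((mem_localSubgroupOfEmb_iff κ.kerSubgroup (closureEmb (K := ℚ) (v.adicCompletion ℚ)) _).1 τ.2)
    have e2 : subgroupInclusion (κ.kerSubgroup_le_layerSubgroup n) (resGalSubgroupOfEmb κ.kerSubgroup (closureEmb (K := ℚ) (v.adicCompletion ℚ)) τ) =
        resGalSubgroupOfEmb (κ.layerSubgroup n) (closureEmb (K := ℚ) (v.adicCompletion ℚ)) ⟨(τ : absoluteGaloisGroup (v.adicCompletion ℚ)), hτn⟩ :=
      Subtype.ext rfl
    rw [contOneCocycles.pullback_apply, contOneCocycles.pullback_apply]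
    change pointsMapOfEmb W (closureEmb (K := ℚ) (v.adicCompletion ℚ)) ((Θ ((((conjCocycle (κ.layerSubgroup n) (resGalOfEmb (closureEmb (K := ℚ) (v.adicCompletion ℚ)) dd) β).1
      (subgroupInclusion (κ.kerSubgroup_le_layerSubgroup n) (resGalSubgroupOfEmb κ.kerSubgroup (closureEmb (K := ℚ) (v.adicCompletion ℚ)) τ)) : ↥(AddSubgroup.torsionBy (Cofree ρ ↥(padicCoeffField S)) ((p ^ k : ℕ) : ℤ))) :
        Cofree ρ ↥(padicCoeffField S))) i : ↥(W.geomPrimaryTorsion p)) : W.geomPoints) = _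
    rw [e2]
    exact thetaKummerWitness_conj S ρ W Θ κ v hΘ n dd hβ ⟨_, hτn⟩ i

end Summit.BirchSwinnertonDyer.BirchSwinnertonDyer.Theorems.ThetaTransport.CofreeSelmerTransfer

end
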